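import Literature.NumberTheory.Automorphic.AshSmithTheoryHeckeProofs
import Literature.NumberTheory.GaloisRepresentations.FramedGaloisRepInduce
import Literature.NumberTheory.GaloisRepresentations.TateTwistFrobeniusProofs
import Literature.NumberTheory.GaloisRepresentations.ArtinRestriction
import HarnessLib

/-!
# Induced, twisted and restricted Galois representations are unramified almost everywhere

Topic `Literature/NumberTheory/GaloisRepresentations`.  Theorem-only file (no named fact, no new
notion): the "being unramified at all but finitely many primes" hypothesis of the potential
automorphy / automorphy lifting theorems (Barnet-Lamb–Gee–Geraghty–Taylor Thm. C, 4.2.1, …) for the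
representations one actually feeds them — restrictions `ρ|_{Γ_E}` (`eventually_isUnramifiedAt_restrictField`),
twists `ρ ⊗ χ` (`eventually_isUnramifiedAt_twist`) and inductions `Ind_{Γ_F}^{Γ_K} ρ`
(`eventually_isUnramifiedAt_induce`) of representations unramified almost everywhere — assembled from
the accepted pointwise statements `isUnramifiedAt_restrictField` (`ArtinRestriction`),
`isUnramifiedAt_twist` (`TateTwistFrobeniusProofs`), `isUnramifiedAt_induce` (`AshSmithTheoryHeckeProofs`)
and the Galois-theoretic finiteness `eventually_forall_inertia_le_range_absGaloisRestrict`
(`FramedGaloisRepInduce`: all but finitely many places are unramified in the Galois closure).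

## References

* J.-P. Serre, *Abelian ℓ-adic representations and elliptic curves* (1968), Ch. I §2.1 (unramified
  places; restriction to subgroups). [SerreAbelianLadic1968]
* J. Neukirch, *Algebraic Number Theory* (1999), Ch. III §2 (only finitely many primes ramify).
  [NeukirchANT1999]
-/

noncomputable section

open NumberField IsDedekindDomain Field Filter

namespace Literature.NumberTheory.GaloisRepresentations

universe u v

section Restrict

variable {F : Type} {E : Type} [Field F] [NumberField F] [Field E] [NumberField E] [Algebra F E]
  {A : Type*} [CommRing A] [TopologicalSpace A] {n : ℕ}

/-- The places of `E` above the finitely many exceptional places of `F` are finitely many: a cofinite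
property of the place BELOW passes to the places above. [folklore] -/
theorem eventually_forall_under_eq {P : HeightOneSpectrum (𝓞 F) → Prop}
    (h : ∀ᶠ v : HeightOneSpectrum (𝓞 F) in cofinite, P v) :
    ∀ᶠ w : HeightOneSpectrum (𝓞 E) in cofinite, ∀ v : HeightOneSpectrum (𝓞 F),
      w.asIdeal.under (𝓞 F) = v.asIdeal → P v := by
  rw [Filter.eventually_cofinite] at h ⊢
  refine (h.biUnion fun v _ => finite_setOf_asIdeal_under_eq (K := F) (F := E) v).subset ?_
  intro w hw
  simp only [Set.mem_setOf_eq, not_forall] at hw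
  obtain ⟨v, hv, hP⟩ := hw
  exact Set.mem_biUnion hP hv

/-- **`ρ|_{Γ_E}` is unramified almost everywhere if `ρ` is.** [cite: SerreAbelianLadic1968, Ch. I §2.1] -/
theorem FramedGaloisRep.eventually_isUnramifiedAt_restrictField (ρ : FramedGaloisRep F A n)
    (h : ∀ᶠ v : HeightOneSpectrum (𝓞 F) in cofinite, ρ.IsUnramifiedAt v) :
    ∀ᶠ w : HeightOneSpectrum (𝓞 E) in cofinite, (ρ.restrictField E).IsUnramifiedAt w := by
  filter_upwards [eventually_forall_under_eq (E := E) h] with w hw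
  exact ρ.isUnramifiedAt_restrictField (v := w.under (𝓞 F)) rfl (hw _ rfl)

end Restrict

section Twist

variable {K : Type} [Field K] {A : Type*} [CommRing A] [TopologicalSpace A] {n : ℕ}

/-- A rank-one framed representation is unramified at `v` iff the character it carries is trivial on
the inertia groups above `v` — in the direction we need: `(scalar ∘ χ)` unramified ⇒ `χ` trivial on
inertia. [folklore] -/
theorem apply_eq_one_of_isUnramifiedAt_scalar_comp {v : HeightOneSpectrum (𝓞 K)}
    {χ : absoluteGaloisGroup K →ₜ* Aˣ}
    (hχ : FramedGaloisRep.IsUnramifiedAt v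
      ((FramedRep.scalar A 1).comp χ : FramedGaloisRep K A 1)) :
    ∀ 𝔓 ∈ v.primesAbove, ∀ σ ∈ 𝔓.inertia (absoluteGaloisGroup K), χ σ = 1 := by
  intro 𝔓 h𝔓 σ hσ
  have h : (FramedRep.scalar A 1) (χ σ) = 1 := hχ 𝔓 h𝔓 σ hσ
  -- `det (scalar a) = a` in rank one
  have hdet : Matrix.GeneralLinearGroup.det ((FramedRep.scalar A 1) (χ σ)) = χ σ := by
    ext
    rw [Matrix.GeneralLinearGroup.val_det_apply, FramedRep.coe_scalar_apply, Matrix.det_fin_one,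
      Matrix.algebraMap_matrix_apply, if_pos rfl, Algebra.algebraMap_self, RingHom.id_apply]
  rw [← hdet, h, map_one]

/-- **`ρ ⊗ χ` is unramified almost everywhere if `ρ` and `χ` are** (`χ` given through its rank-one
framed avatar `scalar ∘ χ`, the tree's idiom for Galois characters). [cite: SerreAbelianLadic1968, Ch. I §2.1] -/
theorem FramedGaloisRep.eventually_isUnramifiedAt_twist [NumberField K] [IsTopologicalRing A]
    (ρ : FramedGaloisRep K A n)
    (χ : absoluteGaloisGroup K →ₜ* Aˣ)
    (hρ : ∀ᶠ v : HeightOneSpectrum (𝓞 K) in cofinite, ρ.IsUnramifiedAt v)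
    (hχ : ∀ᶠ v : HeightOneSpectrum (𝓞 K) in cofinite,
      FramedGaloisRep.IsUnramifiedAt v ((FramedRep.scalar A 1).comp χ : FramedGaloisRep K A 1)) :
    ∀ᶠ v : HeightOneSpectrum (𝓞 K) in cofinite,
      FramedGaloisRep.IsUnramifiedAt v (FramedRep.twist ρ χ) := by
  filter_upwards [hρ, hχ] with v hv hχv
  exact FramedGaloisRep.isUnramifiedAt_twist hv (apply_eq_one_of_isUnramifiedAt_scalar_comp hχv)

end Twist

section Induce

variable (K : Type u) {F : Type v} [Field K] [NumberField K] [Field F] [NumberField F] [Algebra K F]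
  [FiniteDimensional K F] {A : Type*} [CommRing A] [TopologicalSpace A] {n d : ℕ}

omit [NumberField F] in
/-- **`Ind_{Γ_F}^{Γ_K} ρ` is unramified almost everywhere if `ρ` is**: at every place `v` of `K`
which is unramified in the Galois closure of `F` (all but finitely many,
`eventually_forall_inertia_le_range_absGaloisRestrict`) and below no exceptional place of `ρ`
(finitely many), `Ind ρ` is unramified (`isUnramifiedAt_induce`). [cite: SerreAbelianLadic1968, Ch. I §2.1] -/
theorem FramedGaloisRep.eventually_isUnramifiedAt_induce (hd : Module.finrank K F = d)
    (ρ : FramedGaloisRep F A n)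
    (hρ : ∀ᶠ w : HeightOneSpectrum (𝓞 F) in cofinite, ρ.IsUnramifiedAt w) :
    ∀ᶠ v : HeightOneSpectrum (𝓞 K) in cofinite, (ρ.induce K hd).IsUnramifiedAt v := by
  have h2 : ∀ᶠ v : HeightOneSpectrum (𝓞 K) in cofinite, ∀ w : HeightOneSpectrum (𝓞 F),
      w.asIdeal.under (𝓞 K) = v.asIdeal → ρ.IsUnramifiedAt w := by
    rw [Filter.eventually_cofinite] at hρ ⊢
    refine (hρ.image fun w => w.under (𝓞 K)).subset fun v hv => ?_
    simp only [Set.mem_setOf_eq, not_forall] at hv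
    obtain ⟨w, hw, hbad⟩ := hv
    exact ⟨w, hbad, HeightOneSpectrum.ext hw⟩
  filter_upwards [eventually_forall_inertia_le_range_absGaloisRestrict K F, h2] with v hv1 hv2
  exact ρ.isUnramifiedAt_induce K hd hv1 hv2

end Induce

end Literature.NumberTheory.GaloisRepresentations

end
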